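import Literature.MathematicalPhysics.QuantumLattice.InfVolFermionState
import HarnessLib

/-!
# Uniform averages of translates of an infinite-volume fermion state

For a finite nonempty set `S ⊂ ℤ^d` of translation vectors, the uniform average
`ω̄ = |S|⁻¹ Σ_{a ∈ S} ω ∘ τ_a` of the translates of an infinite-volume state `ω` is again a state
(the state space is convex, Bratteli–Robinson I §2.3.2/§4.3.1). If the translates of `ω` by
`v + a`, `a ∈ S`, are a PERMUTATION of the translates by `a ∈ S` for every `v` (the situation of a
state periodic under a sublattice `𝓛` with `S` a complete residue system of `ℤ^d/𝓛`), then `ω̄` is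
translation invariant. This is the standard device turning a periodic trial state into a
translation-invariant one with the cell-averaged local expectations (used for periodic
Hartree–Fock / cluster trial states, e.g. Bach–Lieb–Solovej 1994 §2). [cite: BratteliRobinsonI1987, §4.3.1]
-/

noncomputable section

namespace Literature.MathematicalPhysics.QuantumLattice

open Finset Literature.Probability.LatticeModels
open scoped ComplexOrder

namespace InfVolFermionState

variable {d : ℕ}

/-- The **uniform average of the translates** `ω ∘ τ_a`, `a ∈ S` (`S` finite nonempty):
`ω̄_Λ(A) = |S|⁻¹ Σ_{a∈S} (ω ∘ τ_a)_Λ(A)`. A state: normalised, positive, compatible with isotony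
(each summand is). Bratteli–Robinson I §4.3.1 (convexity of the state space). [cite: BratteliRobinsonI1987, §4.3.1] -/
def shiftAvg (S : Finset (Site d)) (hS : S.Nonempty) (ω : InfVolFermionState d) :
    InfVolFermionState d where
  expect Λ := ((S.card : ℂ)⁻¹) • ∑ a ∈ S, (ω.shift a).expect Λ
  expect_one Λ := by
    have hc : (S.card : ℂ) ≠ 0 := Nat.cast_ne_zero.2 (card_pos.2 hS).ne'
    simp only [LinearMap.smul_apply, LinearMap.coe_sum, Finset.sum_apply, expect_one,
      sum_const, nsmul_eq_mul, mul_one, smul_eq_mul]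
    exact inv_mul_cancel₀ hc
  expect_nonneg Λ A := by
    simp only [LinearMap.smul_apply, LinearMap.coe_sum, Finset.sum_apply, smul_eq_mul]
    refine mul_nonneg ?_ (sum_nonneg fun a _ => (ω.shift a).expect_nonneg Λ A)
    rw [← Complex.ofReal_natCast, ← Complex.ofReal_inv]
    exact Complex.zero_le_real.2 (inv_nonneg.2 (Nat.cast_nonneg _))
  compatible Λ Λ' h A := by
    simp only [LinearMap.smul_apply, LinearMap.coe_sum, Finset.sum_apply, (ω.shift _).compatible h]

/-- The local expectations of the average (definitional unfolding): `ω̄_Λ(A) = |S|⁻¹ Σ_a (ω∘τ_a)_Λ(A)` — the convex combination of Bratteli–Robinson I §4.3.1 written out. [cite: BratteliRobinsonI1987, §4.3.1] -/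
theorem shiftAvg_expect (S : Finset (Site d)) (hS : S.Nonempty) (ω : InfVolFermionState d)
    (Λ : Finset (Site d)) (A : FermionOp Λ) :
    (shiftAvg S hS ω).expect Λ A = ((S.card : ℂ)⁻¹) * ∑ a ∈ S, (ω.shift a).expect Λ A := by
  simp only [shiftAvg, LinearMap.smul_apply, LinearMap.coe_sum, Finset.sum_apply, smul_eq_mul]

/-- Translating the average translates every summand: `ω̄ ∘ τ_v = |S|⁻¹ Σ_a ω ∘ τ_{v+a}` at the
level of local expectations (`τ` is a group action on the state space, Bratteli–Robinson I §4.3.1). [cite: BratteliRobinsonI1987, §4.3.1] -/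
theorem shift_shiftAvg_expect (S : Finset (Site d)) (hS : S.Nonempty) (ω : InfVolFermionState d)
    (v : Site d) (Λ : Finset (Site d)) (A : FermionOp Λ) :
    ((shiftAvg S hS ω).shift v).expect Λ A =
      ((S.card : ℂ)⁻¹) * ∑ a ∈ S, (ω.shift (v + a)).expect Λ A := by
  rw [shift_expect, shiftAvg_expect]
  refine congrArg _ (sum_congr rfl fun a _ => ?_)
  rw [← shift_shift]
  rfl

/-- **The average over a complete system of translates is translation invariant.** If for every
`v ∈ ℤ^d` the family of translates `(ω ∘ τ_{v+a})_{a∈S}` is a permutation of `(ω ∘ τ_a)_{a∈S}` —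
e.g. `ω` is invariant under a sublattice `𝓛` and `S` is a complete residue system mod `𝓛` — then
`ω̄ = |S|⁻¹ Σ_{a∈S} ω ∘ τ_a` is translation invariant. Bratteli–Robinson I §4.3.1 (`G`-invariant states). [cite: BratteliRobinsonI1987, §4.3.1] -/
theorem isTranslationInvariant_shiftAvg (S : Finset (Site d)) (hS : S.Nonempty)
    (ω : InfVolFermionState d)
    (hperm : ∀ v : Site d, ∃ σ : S ≃ S, ∀ a : S, ω.shift (v + (a : Site d)) = ω.shift (σ a : Site d)) :
    (shiftAvg S hS ω).IsTranslationInvariant := by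
  intro v
  obtain ⟨σ, hσ⟩ := hperm v
  refine InfVolFermionState.ext fun Λ => LinearMap.ext fun A => ?_
  rw [shift_shiftAvg_expect, shiftAvg_expect]
  refine congrArg _ ?_
  have h1 : ∑ a ∈ S, (ω.shift (v + a)).expect Λ A = ∑ a : S, (ω.shift (σ a : Site d)).expect Λ A := by
    rw [← sum_coe_sort S]
    exact sum_congr rfl fun a _ => by rw [hσ a]
  have h2 : ∑ a ∈ S, (ω.shift a).expect Λ A = ∑ a : S, (ω.shift (a : Site d)).expect Λ A :=
    (sum_coe_sort S _).symm
  rw [h1, h2]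
  exact σ.sum_comp (fun a : S => (ω.shift (a : Site d)).expect Λ A)

/-- The density of the average is the average of the densities of the translates:
`ρ_x(ω̄) = |S|⁻¹ Σ_a ρ_x(ω ∘ τ_a)` (expectations are affine in the state, Bratteli–Robinson I §4.3.1). [cite: BratteliRobinsonI1987, §4.3.1] -/
theorem densityAt_shiftAvg (S : Finset (Site d)) (hS : S.Nonempty) (ω : InfVolFermionState d)
    (x : Site d) :
    (shiftAvg S hS ω).densityAt x = (S.card : ℝ)⁻¹ * ∑ a ∈ S, (ω.shift a).densityAt x := by
  simp only [densityAt, shiftAvg_expect]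
  rw [← Complex.ofReal_natCast, ← Complex.ofReal_inv, Complex.re_ofReal_mul, Complex.re_sum]

/-- The density `ρ(ω̄) = |S|⁻¹ Σ_a ρ(ω ∘ τ_a)` (affine). [cite: BratteliRobinsonI1987, §4.3.1] -/
theorem density_shiftAvg (S : Finset (Site d)) (hS : S.Nonempty) (ω : InfVolFermionState d) :
    (shiftAvg S hS ω).density = (S.card : ℝ)⁻¹ * ∑ a ∈ S, (ω.shift a).density :=
  densityAt_shiftAvg S hS ω 0

/-- **The mean energy is affine on the average**: `e_Φ(ω̄) = |S|⁻¹ Σ_a e_Φ(ω ∘ τ_a)` (Bratteli–Kishimoto–Robinson 1978 §3: the mean energy functional is affine). [cite: BratteliKishimotoRobinson1978, §3] -/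
theorem meanEnergy_shiftAvg (Ψ : FermionInteraction d) (R : ℝ) (S : Finset (Site d))
    (hS : S.Nonempty) (ω : InfVolFermionState d) :
    (shiftAvg S hS ω).meanEnergy Ψ R = (S.card : ℝ)⁻¹ * ∑ a ∈ S, (ω.shift a).meanEnergy Ψ R := by
  simp only [meanEnergy, shiftAvg_expect]
  rw [← Complex.ofReal_natCast, ← Complex.ofReal_inv, Complex.re_ofReal_mul, Complex.re_sum]

/-- The Hubbard energy density of the average: `e(ω̄) = |S|⁻¹ Σ_a e(ω ∘ τ_a)` (affine mean energy, Bratteli–Kishimoto–Robinson 1978 §3, for the Hubbard interaction). [cite: BratteliKishimotoRobinson1978, §3] -/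
theorem hubbardEnergyDensity_shiftAvg (t U : ℝ) (S : Finset (Site d)) (hS : S.Nonempty)
    (ω : InfVolFermionState d) :
    (shiftAvg S hS ω).hubbardEnergyDensity t U =
      (S.card : ℝ)⁻¹ * ∑ a ∈ S, (ω.shift a).hubbardEnergyDensity t U :=
  meanEnergy_shiftAvg _ _ S hS ω

end InfVolFermionState

end Literature.MathematicalPhysics.QuantumLattice

end
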